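import Summits.Ventures.PercRepro.C025ProfilePLDBridgeTruncate
import Summits.Ventures.PercRepro.C025ProfileParallelClassesArith

/-!
# PER-LAYER DOMINANCE ON EVERY PARALLEL-CLASSES MATROID: C-025 ON EVERY TRUNCATION OF «PARALLEL CLASSES PLUS FREE POINTS»
(night-3 g29)

`proofs/NIGHT3-G29-PARALLEL.md` §2.  The parallel-classes matroid of a class map `c : α → β` on a finite ground set `E` is
Mathlib's `(freeOn univ).comapOn ↑E c`: a set is independent iff `c` is injective on it, so the rank of `X ⊆ E` is the
number `#(X.image c)` of classes it meets (`eRk_comapOn`), and `⊕_j U_{1,m_j}` (any class sizes `m_j ≥ 1`; a free point is a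
class of one element) is the special case `E = ⊔ P_j`.  For `I ⊆ E` the classes split into the FULL ones (`P_j ⊆ I`), the
PROPER ones and the rest; removing the full classes gives a set `R` with no full class, and `I = R ∪ P_Φ` for the set `Φ` of
full classes, which ranges freely over the classes not met by `R` (`fibre_eq_image`).  Hence both sides of PER-LAYER
DOMINANCE are sums over `R` of window sums of `T(φ) = C(n, φ)·C(n + s − φ, δ)` (`s` = classes met by `R`, `n` = the others),
and the mirror inequality `ParallelPLD.per_s` closes each fibre: `pld_of_parallelClasses` is the hPLD binder of the landed
bridge `PLDBridge.rls_disjointSum_freeOn_of_pld` VERBATIM, and `rls_truncate_disjointSum_freeOn_of_parallelClasses` is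
C-025 at every `(p, q)` on every truncation of «any number of parallel classes of any sizes, plus free points».
No bad-source rule, no Hall lemma, no element-level injection: on this model (PLD) is one binomial identity for all sizes.
No `def`, no `instance`, no notation.  Axioms: standard.
-/

open scoped Matroid

namespace PercRepro

open Finset ThmH

namespace ParallelPLD

variable {α β : Type} [DecidableEq α] [DecidableEq β]

/-! ### The matroid: `(freeOn univ).comapOn ↑E c` — finite, ground finset `E`, rank = classes met -/

omit [DecidableEq α] [DecidableEq β] in
/-- The parallel-classes matroid of `c` on the finite set `E` is finite (a theorem, not an instance). -/
theorem comapOn_finite (c : α → β) (E : Finset α) :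
    ((Matroid.freeOn (Set.univ : Set β)).comapOn (E : Set α) c).Finite :=
  ⟨by rw [Matroid.comapOn_ground_eq]; exact E.finite_toSet⟩

omit [DecidableEq α] [DecidableEq β] in
/-- Its ground finset is `E`. -/
theorem gr_comapOn (c : α → β) (E : Finset α) :
    haveI := comapOn_finite c E
    gr ((Matroid.freeOn (Set.univ : Set β)).comapOn (E : Set α) c) = E := by
  haveI := comapOn_finite c E
  apply Finset.coe_injective
  rw [coe_gr, Matroid.comapOn_ground_eq]

omit [DecidableEq α] in
/-- The rank of `X ⊆ E` is the number of classes it meets: a basis of `X` picks one point of each class met. -/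
theorem eRk_comapOn (c : α → β) (E X : Finset α) (hX : X ⊆ E) :
    ((Matroid.freeOn (Set.univ : Set β)).comapOn (E : Set α) c).eRk (X : Set α) = ((X.image c).card : ℕ∞) := by
  rw [Matroid.comapOn, Matroid.restrict_eRk_eq _ (Finset.coe_subset.2 hX)]
  obtain ⟨I, hI⟩ := ((Matroid.freeOn (Set.univ : Set β)).comap c).exists_isBasis' (X : Set α)
  rw [← hI.encard_eq_eRk]
  rw [Matroid.comap_isBasis'_iff, Matroid.freeOn_isBasis'_iff, Set.inter_univ] at hI
  obtain ⟨hIX, hinj, -⟩ := hI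
  rw [← hinj.encard_image, hIX, ← Finset.coe_image, Set.encard_coe_eq_coe_finsetCard]

/-! ### The class bookkeeping: full classes, the reduced set, the block of a set of classes -/

/-- `j` is a full class of `I`: it is a class of `E` and every point of `E` in it lies in `I`. -/
theorem mem_full_iff (c : α → β) (E I : Finset α) (j : β) :
    j ∈ (E.image c).filter (fun j => E.filter (fun x => c x = j) ⊆ I) ↔
      (∃ x ∈ E, c x = j) ∧ ∀ x ∈ E, c x = j → x ∈ I := by
  simp only [mem_filter, mem_image, Finset.subset_iff, and_imp]

/-- The reduced set `R = I ∖ P_{full I}` has no full class. -/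
theorem full_rest_eq_empty (c : α → β) (E I : Finset α) :
    (E.image c).filter (fun j => E.filter (fun x => c x = j) ⊆
      I.filter (fun x => c x ∉ (E.image c).filter (fun j => E.filter (fun x => c x = j) ⊆ I))) = ∅ := by
  rw [Finset.eq_empty_iff_forall_notMem]
  intro j hj
  rw [mem_full_iff] at hj
  obtain ⟨⟨x, hxE, hxj⟩, hall⟩ := hj
  have hx := hall x hxE hxj
  rw [mem_filter] at hx
  apply hx.2
  rw [mem_full_iff]
  refine ⟨⟨x, hxE, rfl⟩, fun y hyE hyj => ?_⟩
  exact (mem_filter.1 (hall y hyE (hyj.trans hxj))).1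

/-- Reduction is idempotent. -/
theorem rest_rest (c : α → β) (E I : Finset α) :
    (I.filter (fun x => c x ∉ (E.image c).filter (fun j => E.filter (fun x => c x = j) ⊆ I))).filter
      (fun x => c x ∉ (E.image c).filter (fun j => E.filter (fun x => c x = j) ⊆
        I.filter (fun x => c x ∉ (E.image c).filter (fun j => E.filter (fun x => c x = j) ⊆ I)))) =
      I.filter (fun x => c x ∉ (E.image c).filter (fun j => E.filter (fun x => c x = j) ⊆ I)) := by
  rw [full_rest_eq_empty]
  exact Finset.filter_true_of_mem fun x _ => Finset.notMem_empty _

/-- If `R` is reduced (`R = rest R`) then `R` has no full class. -/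
theorem full_eq_empty_of_rest_eq (c : α → β) (E R : Finset α)
    (hR : R.filter (fun x => c x ∉ (E.image c).filter (fun j => E.filter (fun x => c x = j) ⊆ R)) = R) :
    (E.image c).filter (fun j => E.filter (fun x => c x = j) ⊆ R) = ∅ := by
  rw [Finset.eq_empty_iff_forall_notMem]
  intro j hj
  have hj' := hj
  rw [mem_full_iff] at hj'
  obtain ⟨⟨x, hxE, hxj⟩, hall⟩ := hj'
  have hxR := hall x hxE hxj
  rw [← hR, mem_filter] at hxR
  exact hxR.2 (by rw [hxj]; exact hj)

/-- For `R` with no full class and `Φ` a set of classes not met by `R`: the full classes of `R ∪ P_Φ` are exactly `Φ`. -/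
theorem full_union_blk (c : α → β) (E R : Finset α)
    (hR : (E.image c).filter (fun j => E.filter (fun x => c x = j) ⊆ R) = ∅)
    (Φ : Finset β) (hΦ : Φ ⊆ E.image c \ R.image c) :
    (E.image c).filter (fun j => E.filter (fun x => c x = j) ⊆ R ∪ E.filter (fun x => c x ∈ Φ)) = Φ := by
  ext j
  rw [mem_full_iff]
  constructor
  · rintro ⟨⟨x, hxE, hxj⟩, hall⟩
    by_contra hjΦ
    have : j ∈ (E.image c).filter (fun j => E.filter (fun x => c x = j) ⊆ R) := by
      rw [mem_full_iff]
      refine ⟨⟨x, hxE, hxj⟩, fun y hyE hyj => ?_⟩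
      rcases mem_union.1 (hall y hyE hyj) with h | h
      · exact h
      · rw [mem_filter] at h
        exact absurd (hyj ▸ h.2) hjΦ
    rw [hR] at this
    exact Finset.notMem_empty _ this
  · intro hjΦ
    have hjK := (mem_sdiff.1 (hΦ hjΦ)).1
    rw [mem_image] at hjK
    refine ⟨hjK, fun y hyE hyj => ?_⟩
    exact mem_union_right _ (mem_filter.2 ⟨hyE, hyj ▸ hjΦ⟩)

/-- For `R` with no full class and `Φ` not met by `R`: the reduced set of `R ∪ P_Φ` is `R`. -/
theorem rest_union_blk (c : α → β) (E R : Finset α)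
    (hR : (E.image c).filter (fun j => E.filter (fun x => c x = j) ⊆ R) = ∅)
    (Φ : Finset β) (hΦ : Φ ⊆ E.image c \ R.image c) :
    (R ∪ E.filter (fun x => c x ∈ Φ)).filter (fun x => c x ∉ (E.image c).filter
      (fun j => E.filter (fun x => c x = j) ⊆ R ∪ E.filter (fun x => c x ∈ Φ))) = R := by
  rw [full_union_blk c E R hR Φ hΦ]
  ext x
  rw [mem_filter, mem_union, mem_filter]
  constructor
  · rintro ⟨h | ⟨_, h⟩, hx⟩
    · exact h
    · exact absurd h hx
  · intro hxR
    refine ⟨Or.inl hxR, fun hcx => ?_⟩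
    have := hΦ hcx
    rw [mem_sdiff] at this
    exact this.2 (mem_image.2 ⟨x, hxR, rfl⟩)

/-- The classes met by `R ∪ P_Φ`: `met R ∪ Φ`, a disjoint union. -/
theorem image_union_blk (c : α → β) (E R : Finset α) (Φ : Finset β) (hΦ : Φ ⊆ E.image c \ R.image c) :
    (R ∪ E.filter (fun x => c x ∈ Φ)).image c = R.image c ∪ Φ := by
  rw [image_union]
  congr 1
  ext j
  rw [mem_image]
  constructor
  · rintro ⟨x, hx, rfl⟩
    exact (mem_filter.1 hx).2
  · intro hj
    have hjK := (mem_sdiff.1 (hΦ hj)).1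
    obtain ⟨x, hxE, rfl⟩ := mem_image.1 hjK
    exact ⟨x, mem_filter.2 ⟨hxE, hj⟩, rfl⟩

/-- The number of classes met by `R ∪ P_Φ` is `#(met R) + #Φ`. -/
theorem card_image_union_blk (c : α → β) (E R : Finset α) (Φ : Finset β)
    (hΦ : Φ ⊆ E.image c \ R.image c) :
    ((R ∪ E.filter (fun x => c x ∈ Φ)).image c).card = (R.image c).card + Φ.card := by
  rw [image_union_blk c E R Φ hΦ, card_union_of_disjoint]
  rw [disjoint_left]
  intro j hj hjΦ
  exact (mem_sdiff.1 (hΦ hjΦ)).2 hj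

/-- The classes met by the complement of `R ∪ P_Φ` (with `R` having no full class): all classes except `Φ`. -/
theorem image_sdiff_union_blk (c : α → β) (E R : Finset α)
    (hR : (E.image c).filter (fun j => E.filter (fun x => c x = j) ⊆ R) = ∅) (Φ : Finset β) :
    (E \ (R ∪ E.filter (fun x => c x ∈ Φ))).image c = E.image c \ Φ := by
  ext j
  rw [mem_image, mem_sdiff, mem_image]
  constructor
  · rintro ⟨x, hx, rfl⟩
    rw [mem_sdiff, mem_union, mem_filter, not_or, not_and] at hx
    exact ⟨⟨x, hx.1, rfl⟩, hx.2.2 hx.1⟩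
  · rintro ⟨⟨x, hxE, rfl⟩, hjΦ⟩
    -- `c x` is a class of `E` not full in `R`: some point of it is outside `R`
    have hnot : c x ∉ (E.image c).filter (fun j => E.filter (fun x => c x = j) ⊆ R) := by
      rw [hR]; exact Finset.notMem_empty _
    rw [mem_full_iff, not_and_or, not_forall] at hnot
    rcases hnot with h | ⟨y, hy⟩
    · exact absurd ⟨x, hxE, rfl⟩ h
    · rw [not_forall] at hy
      obtain ⟨hyE, hy⟩ := hy
      rw [not_forall] at hy
      obtain ⟨hyj, hyR⟩ := hy
      refine ⟨y, ?_, hyj⟩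
      rw [mem_sdiff, mem_union, mem_filter, not_or, not_and]
      exact ⟨hyE, hyR, fun _ => hyj ▸ hjΦ⟩

/-- The corank count: `#(met (E ∖ (R ∪ P_Φ))) = #K − #Φ`. -/
theorem card_image_sdiff_union_blk (c : α → β) (E R : Finset α)
    (hR : (E.image c).filter (fun j => E.filter (fun x => c x = j) ⊆ R) = ∅)
    (Φ : Finset β) (hΦ : Φ ⊆ E.image c \ R.image c) :
    ((E \ (R ∪ E.filter (fun x => c x ∈ Φ))).image c).card = (E.image c).card - Φ.card := by
  rw [image_sdiff_union_blk c E R hR Φ, card_sdiff_of_subset (hΦ.trans sdiff_subset)]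

/-- Every `I ⊆ E` is `rest I ∪ P_{full I}`, with `full I` a set of classes not met by `rest I`. -/
theorem eq_rest_union_blk (c : α → β) (E I : Finset α) (hIE : I ⊆ E) :
    I = I.filter (fun x => c x ∉ (E.image c).filter (fun j => E.filter (fun x => c x = j) ⊆ I)) ∪
      E.filter (fun x => c x ∈ (E.image c).filter (fun j => E.filter (fun x => c x = j) ⊆ I)) := by
  ext x
  constructor
  · intro hx
    by_cases h : c x ∈ (E.image c).filter (fun j => E.filter (fun x => c x = j) ⊆ I)
    · exact mem_union_right _ (mem_filter.2 ⟨hIE hx, h⟩)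
    · exact mem_union_left _ (mem_filter.2 ⟨hx, h⟩)
  · intro hx
    rcases mem_union.1 hx with h | h
    · exact (mem_filter.1 h).1
    · obtain ⟨hxE, hx⟩ := mem_filter.1 h
      rw [mem_full_iff] at hx
      exact hx.2 x hxE rfl

/-- The full classes of `I` are not met by `rest I`. -/
theorem full_subset_sdiff (c : α → β) (E I : Finset α) :
    (E.image c).filter (fun j => E.filter (fun x => c x = j) ⊆ I) ⊆
      E.image c \ (I.filter (fun x => c x ∉ (E.image c).filter
        (fun j => E.filter (fun x => c x = j) ⊆ I))).image c := by
  intro j hj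
  rw [mem_sdiff]
  refine ⟨(mem_filter.1 hj).1, ?_⟩
  intro h
  obtain ⟨x, hx, rfl⟩ := mem_image.1 h
  rw [mem_filter] at hx
  exact hx.2 hj

/-- THE FIBRE: for a reduced `R ⊆ E`, the sets `I ⊆ E` with `rest I = R` are exactly the `R ∪ P_Φ`, `Φ` a set of classes
not met by `R`. -/
theorem fibre_eq_image (c : α → β) (E R : Finset α) (hRE : R ⊆ E)
    (hR : (E.image c).filter (fun j => E.filter (fun x => c x = j) ⊆ R) = ∅) :
    E.powerset.filter (fun I => I.filter (fun x => c x ∉ (E.image c).filter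
        (fun j => E.filter (fun x => c x = j) ⊆ I)) = R) =
      (E.image c \ R.image c).powerset.image (fun Φ => R ∪ E.filter (fun x => c x ∈ Φ)) := by
  ext I
  rw [mem_filter, mem_powerset, mem_image]
  constructor
  · rintro ⟨hIE, hI⟩
    refine ⟨(E.image c).filter (fun j => E.filter (fun x => c x = j) ⊆ I), ?_, ?_⟩
    · rw [mem_powerset, ← hI]
      exact full_subset_sdiff c E I
    · rw [← hI]
      exact (eq_rest_union_blk c E I hIE).symm
  · rintro ⟨Φ, hΦ, rfl⟩
    rw [mem_powerset] at hΦ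
    refine ⟨union_subset hRE (filter_subset _ _), rest_union_blk c E R hR Φ hΦ⟩

/-- The parametrisation of the fibre is injective (the full classes of `R ∪ P_Φ` are `Φ`). -/
theorem injOn_union_blk (c : α → β) (E R : Finset α)
    (hR : (E.image c).filter (fun j => E.filter (fun x => c x = j) ⊆ R) = ∅) :
    Set.InjOn (fun Φ : Finset β => R ∪ E.filter (fun x => c x ∈ Φ))
      ↑((E.image c \ R.image c).powerset) := by
  intro Φ₁ hΦ₁ Φ₂ hΦ₂ h
  rw [Finset.mem_coe, mem_powerset] at hΦ₁ hΦ₂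
  have h1 := full_union_blk c E R hR Φ₁ hΦ₁
  have h2 := full_union_blk c E R hR Φ₂ hΦ₂
  simp only at h
  rw [← h1, ← h2, h]

/-! ### The count: both sides of (PLD) fibrewise, and the mirror inequality on each fibre -/

/-- Both sides of PER-LAYER DOMINANCE for the class counts, as a pure statement about `c` and `E`. -/
theorem count_le (c : α → β) (E : Finset α) (lo hi δ Θ : ℕ) (hlo : lo = 0 ∨ lo + hi + δ ≤ Θ) :
    (∑ I ∈ E.powerset, (if lo ≤ (I.image c).card ∧ (I.image c).card ≤ hi ∧
        Θ ≤ ((E \ I).image c).card + (I.image c).card then ((E \ I).image c).card.choose δ else 0)) ≤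
      ∑ I ∈ E.powerset, (if lo + δ ≤ ((E \ I).image c).card ∧ ((E \ I).image c).card ≤ hi + δ then
        ((E \ I).image c).card.choose δ else 0) := by
  -- the reduction map `I ↦ rest I` sends `E.powerset` to itself
  have hmaps : ∀ I ∈ E.powerset,
      I.filter (fun x => c x ∉ (E.image c).filter (fun j => E.filter (fun x => c x = j) ⊆ I)) ∈ E.powerset := by
    intro I hI
    rw [mem_powerset] at hI ⊢
    exact (filter_subset _ _).trans hI
  conv_lhs => rw [← Finset.sum_fiberwise_of_maps_to hmaps]
  conv_rhs => rw [← Finset.sum_fiberwise_of_maps_to hmaps]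
  refine Finset.sum_le_sum fun R hR => ?_
  rw [mem_powerset] at hR
  by_cases hred : R.filter (fun x => c x ∉ (E.image c).filter (fun j => E.filter (fun x => c x = j) ⊆ R)) = R
  · -- `R` is reduced: the fibre is `{R ∪ P_Φ}`
    have hfull := full_eq_empty_of_rest_eq c E R hred
    rw [fibre_eq_image c E R hR hfull, Finset.sum_image (injOn_union_blk c E R hfull),
      Finset.sum_image (injOn_union_blk c E R hfull)]
    -- rewrite the summands through the class counts
    have hL : ∀ Φ ∈ (E.image c \ R.image c).powerset,
        (if lo ≤ ((R ∪ E.filter (fun x => c x ∈ Φ)).image c).card ∧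
            ((R ∪ E.filter (fun x => c x ∈ Φ)).image c).card ≤ hi ∧
            Θ ≤ ((E \ (R ∪ E.filter (fun x => c x ∈ Φ))).image c).card +
              ((R ∪ E.filter (fun x => c x ∈ Φ)).image c).card then
          ((E \ (R ∪ E.filter (fun x => c x ∈ Φ))).image c).card.choose δ else 0) =
        (if lo ≤ (R.image c).card + Φ.card ∧ (R.image c).card + Φ.card ≤ hi ∧
            Θ ≤ ((E.image c \ R.image c).card + (R.image c).card - Φ.card) + ((R.image c).card + Φ.card) then
          ((E.image c \ R.image c).card + (R.image c).card - Φ.card).choose δ else 0) := by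
      intro Φ hΦ
      rw [mem_powerset] at hΦ
      have hk : (E.image c).card = (E.image c \ R.image c).card + (R.image c).card := by
        rw [card_sdiff_of_subset (image_subset_image hR)]
        have := card_le_card (image_subset_image hR : R.image c ⊆ E.image c)
        omega
      rw [card_image_union_blk c E R Φ hΦ, card_image_sdiff_union_blk c E R hfull Φ hΦ, hk]
    have hR' : ∀ Φ ∈ (E.image c \ R.image c).powerset,
        (if lo + δ ≤ ((E \ (R ∪ E.filter (fun x => c x ∈ Φ))).image c).card ∧
            ((E \ (R ∪ E.filter (fun x => c x ∈ Φ))).image c).card ≤ hi + δ then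
          ((E \ (R ∪ E.filter (fun x => c x ∈ Φ))).image c).card.choose δ else 0) =
        (if lo + δ ≤ (E.image c \ R.image c).card + (R.image c).card - Φ.card ∧
            (E.image c \ R.image c).card + (R.image c).card - Φ.card ≤ hi + δ then
          ((E.image c \ R.image c).card + (R.image c).card - Φ.card).choose δ else 0) := by
      intro Φ hΦ
      rw [mem_powerset] at hΦ
      have hk : (E.image c).card = (E.image c \ R.image c).card + (R.image c).card := by
        rw [card_sdiff_of_subset (image_subset_image hR)]
        have := card_le_card (image_subset_image hR : R.image c ⊆ E.image c)
        omega
      rw [card_image_sdiff_union_blk c E R hfull Φ hΦ, hk]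
    rw [Finset.sum_congr rfl hL, Finset.sum_congr rfl hR']
    have eL := Finset.sum_powerset_apply_card (x := E.image c \ R.image c)
      (fun φ => if lo ≤ (R.image c).card + φ ∧ (R.image c).card + φ ≤ hi ∧
          Θ ≤ ((E.image c \ R.image c).card + (R.image c).card - φ) + ((R.image c).card + φ) then
        ((E.image c \ R.image c).card + (R.image c).card - φ).choose δ else 0)
    have eR := Finset.sum_powerset_apply_card (x := E.image c \ R.image c)
      (fun φ => if lo + δ ≤ (E.image c \ R.image c).card + (R.image c).card - φ ∧
          (E.image c \ R.image c).card + (R.image c).card - φ ≤ hi + δ then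
        ((E.image c \ R.image c).card + (R.image c).card - φ).choose δ else 0)
    simp only [smul_eq_mul] at eL eR
    rw [eL, eR]
    exact per_s (E.image c \ R.image c).card (R.image c).card δ lo hi Θ hlo
  · -- `R` is not reduced: the fibre is empty (reduction is idempotent)
    have hempty : E.powerset.filter (fun I => I.filter (fun x => c x ∉ (E.image c).filter
        (fun j => E.filter (fun x => c x = j) ⊆ I)) = R) = ∅ := by
      rw [Finset.filter_eq_empty_iff]
      intro I _ hI
      apply hred
      have := rest_rest c E I
      rw [hI] at this
      exact this
    rw [hempty, Finset.sum_empty, Finset.sum_empty]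

/-! ### The theorems -/

/-- PER-LAYER DOMINANCE on every parallel-classes matroid — the hPLD binder of
`PLDBridge.rls_disjointSum_freeOn_of_pld` verbatim. -/
theorem pld_of_parallelClasses (c : α → β) (E : Finset α) :
    haveI := comapOn_finite c E
    ∀ lo hi δ Θ : ℕ, Θ ≤ lo + hi + δ → (lo = 0 ∨ lo + hi + δ ≤ Θ) →
      (∑ I ∈ (gr ((Matroid.freeOn (Set.univ : Set β)).comapOn (E : Set α) c)).powerset,
        (if lo ≤ (((Matroid.freeOn (Set.univ : Set β)).comapOn (E : Set α) c).eRk (I : Set α)).toNat ∧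
          (((Matroid.freeOn (Set.univ : Set β)).comapOn (E : Set α) c).eRk (I : Set α)).toNat ≤ hi ∧
          Θ ≤ (((Matroid.freeOn (Set.univ : Set β)).comapOn (E : Set α) c).eRk
            ((gr ((Matroid.freeOn (Set.univ : Set β)).comapOn (E : Set α) c) \ I : Finset α) : Set α)).toNat +
            (((Matroid.freeOn (Set.univ : Set β)).comapOn (E : Set α) c).eRk (I : Set α)).toNat then
          ((((Matroid.freeOn (Set.univ : Set β)).comapOn (E : Set α) c).eRk
            ((gr ((Matroid.freeOn (Set.univ : Set β)).comapOn (E : Set α) c) \ I : Finset α) : Set α)).toNat).choose δ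
        else 0)) ≤
      ∑ I ∈ (gr ((Matroid.freeOn (Set.univ : Set β)).comapOn (E : Set α) c)).powerset,
        (if lo + δ ≤ (((Matroid.freeOn (Set.univ : Set β)).comapOn (E : Set α) c).eRk
            ((gr ((Matroid.freeOn (Set.univ : Set β)).comapOn (E : Set α) c) \ I : Finset α) : Set α)).toNat ∧
          (((Matroid.freeOn (Set.univ : Set β)).comapOn (E : Set α) c).eRk
            ((gr ((Matroid.freeOn (Set.univ : Set β)).comapOn (E : Set α) c) \ I : Finset α) : Set α)).toNat ≤ hi + δ then
          ((((Matroid.freeOn (Set.univ : Set β)).comapOn (E : Set α) c).eRk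
            ((gr ((Matroid.freeOn (Set.univ : Set β)).comapOn (E : Set α) c) \ I : Finset α) : Set α)).toNat).choose δ
        else 0) := by
  haveI := comapOn_finite c E
  intro lo hi δ Θ _ hlo
  rw [gr_comapOn]
  refine (Finset.sum_congr rfl fun I hI => ?_).trans_le
    ((count_le c E lo hi δ Θ hlo).trans_eq (Finset.sum_congr rfl fun I _ => ?_))
  · rw [mem_powerset] at hI
    rw [eRk_comapOn c E I hI, eRk_comapOn c E (E \ I) sdiff_subset, ENat.toNat_coe, ENat.toNat_coe]
  · rw [eRk_comapOn c E (E \ I) sdiff_subset, ENat.toNat_coe]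

/-- C-025 AT EVERY `(p, q)` ON EVERY TRUNCATION OF «PARALLEL CLASSES PLUS FREE POINTS»: for every class map `c`, every
finite `E` (the parallel-classes matroid `⊕_j U_{1,m_j}`, `m_j = #(c⁻¹ j ∩ E)`), every finite `E₃` disjoint from `E`, every
`r`, `p`, `q`. -/
theorem rls_truncate_disjointSum_freeOn_of_parallelClasses (c : α → β) (E : Finset α) (E₃ : Finset α)
    (h : Disjoint ((Matroid.freeOn (Set.univ : Set β)).comapOn (E : Set α) c).E (E₃ : Set α)) (r p q : ℕ) :
    haveI := comapOn_finite c E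
    haveI := PLDBridge.disjointSum_freeOn_finite _ E₃ h
    ThmN.RLS (PercRepro.Matroid.truncate
      (((Matroid.freeOn (Set.univ : Set β)).comapOn (E : Set α) c).disjointSum
        (Matroid.freeOn (E₃ : Set α)) h) r) p q := by
  haveI := comapOn_finite c E
  exact PLDBridge.rls_disjointSum_freeOn_of_pld _ E₃ h r p q (pld_of_parallelClasses c E)

end ParallelPLD

end PercRepro
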